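import Mathlib
import Summits.Ventures.PercRepro.TriangleCapBipStar
import Summits.Ventures.PercRepro.TriangleCapClosedFormStability

/-!
# PercRepro — THE DEGREE ARGUMENT AT EQUALITY: where the closed form is tight (p3, gen 41; part 167)

The three steps of the degree argument (parts 158–161, 166) with their slack made explicit, for the equality
locus of the closed form §10av on the cell `m + a² + r = a k`, `3 ≤ a`, `2a + r ≤ k`:
* `band_stability_of_min_degree_strict`: every degree `≥ a` ⇒ `Σ_v d(v)² + r k ≤ m k` — for `r ≥ 1` this is
  STRICTLY below the closed form `m k − r (k − 1 − r)` (by `r (r + 1)`): an extremal graph has a vertex of degree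
  `< a`;
* `band_of_low_degree_cross_strict`: a vertex of degree `d` with `r + d < a` ⇒ `Σ_v d(v)² + r (k − 1 − r) + 1 ≤ m k`:
  the cross-row deletion is never tight;
* `band_of_low_degree_eq`: a vertex `z` of degree `d < a` with `r + d ≥ a` on an EXTREMAL graph ⇒ `d = a − 1` or
  `r + d = a`, every neighbour of `z` sits at the cap `k − a`, and `D − z` is extremal on the cell `r + d − a` of the
  same row at `k − 1` (the slack `(a − 1 − d)(r − a + d)` and the two bounds it rests on all vanish);
* `bipSub_of_del`: the transport — if `D − z` is a spanning subgraph of `K(A', A'ᶜ)` with `|A'| = a`, every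
  neighbour of `z` sits at the cap, and `k − 1 − a > a` or `d(z) ≥ 3`, then `D` is a spanning subgraph of some
  `K(A, Aᶜ)` with `|A| = a` (the neighbours of `z` lie on one side: by the degree count when the sides differ in
  size, by `K₄⁻`-freeness when `k − 1 = 2a`, where a neighbour of `z` is adjacent to the whole other side).
Axioms: standard.
-/

namespace PercRepro

namespace TriangleCap

namespace C047

open Finset

variable {V : Type*} [Fintype V] [DecidableEq V]

omit [DecidableEq V] in
/-- **EVERY DEGREE `≥ a`, THE SHARP FORM:** `Σ_v d(v)² + r k ≤ m k` — below the closed form by `r (r + 1)`. -/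
theorem band_stability_of_min_degree_strict (D : SimpleGraph V) [DecidableRel D.Adj] (a r : ℕ)
    (hcap : ∀ v, deg D v + a ≤ Fintype.card V) (hdeg : ∀ z, a ≤ deg D z)
    (hk : r + 2 * a ≤ Fintype.card V) (hm : D.edgeFinset.card + a * a + r = a * Fintype.card V) :
    ∑ v, deg D v * deg D v + r * Fintype.card V ≤ D.edgeFinset.card * Fintype.card V := by
  have hsum := sum_deg_eq D
  obtain ⟨f, hf⟩ : ∃ f : V → ℕ, ∀ v, deg D v = f v + a :=
    ⟨fun v => deg D v - a, fun v => (Nat.sub_add_cancel (hdeg v)).symm⟩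
  have e1 : ∑ v, deg D v = ∑ v, f v + a * Fintype.card V := by
    rw [sum_congr rfl (fun v _ => hf v), sum_add_distrib, sum_const, smul_eq_mul, card_univ]
    ring
  have e2 : ∀ v, deg D v * deg D v = f v * f v + 2 * a * f v + a * a := fun v => by rw [hf v]; ring
  have e3 : ∑ v, deg D v * deg D v = ∑ v, f v * f v + 2 * a * ∑ v, f v + a * a * Fintype.card V := by
    rw [sum_congr rfl (fun v _ => e2 v), sum_add_distrib, sum_add_distrib, ← mul_sum, sum_const, smul_eq_mul,
      card_univ]
    ring
  have hfcap : ∀ v, f v + 2 * a ≤ Fintype.card V := fun v => by have := hcap v; rw [hf v] at this; omega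
  have hA := sum_sq_le_mul_sum f (Fintype.card V - 2 * a) (fun v => by have := hfcap v; omega)
  obtain ⟨t, ht⟩ : ∃ t, Fintype.card V = r + 2 * a + t := ⟨Fintype.card V - (r + 2 * a), by omega⟩
  rw [e3, ht]
  have e5 : r + 2 * a + t - 2 * a = r + t := by omega
  rw [ht, e5] at hA
  rw [ht] at e1 hm
  generalize hS2 : ∑ v, f v * f v = S2 at hA
  generalize hS1 : ∑ v, f v = S1 at hA e1
  generalize hM : D.edgeFinset.card = M at hm hsum
  have hs : S1 + a * (r + 2 * a + t) = 2 * M := by omega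
  have hsk : (S1 + a * (r + 2 * a + t)) * (r + 2 * a + t) = 2 * M * (r + 2 * a + t) := by rw [hs]
  have hmk : (M + a * a + r) * (r + 2 * a + t) = a * (r + 2 * a + t) * (r + 2 * a + t) := by rw [hm]
  nlinarith [hA, hsk, hmk]

/-- The middle term of the deletion identity with a constant summand: `Σ_{x ∼ z} c = d(z) · c`. -/
theorem sum_del_nbhd_const (D : SimpleGraph V) [DecidableRel D.Adj] (z : V) (c : ℕ) :
    ∑ a : {v : V // v ≠ z}, (if D.Adj a.1 z then c else 0) = deg D z * c := by
  have h2 : ∑ a : {v : V // v ≠ z}, (if D.Adj a.1 z then c else 0) =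
      c * ∑ a : {v : V // v ≠ z}, (if D.Adj a.1 z then 1 else 0) := by
    rw [mul_sum]
    apply sum_congr rfl
    intro a _
    by_cases h : D.Adj a.1 z <;> simp [h]
  have h3 : ∑ a : {v : V // v ≠ z}, (if D.Adj a.1 z then 1 else 0) = deg D z := by
    unfold deg
    rw [sum_del z (fun v => if D.Adj v z then 1 else 0), ← sum_filter, card_eq_sum_ones]
    apply sum_congr _ (fun _ _ => rfl)
    ext w
    simp only [mem_filter, mem_erase, mem_univ, true_and, and_true]
    constructor
    · rintro ⟨-, h⟩; exact h.symm
    · intro h; exact ⟨h.ne.symm, h.symm⟩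
  rw [h2, h3, mul_comm]

/-- **The middle term is exact only at the cap:** if `Σ_{x ∼ z} d_{D−z}(x) = d(z) · c` under `d ≤ c + 1`, every
neighbour of `z` has `d_{D−z}(x) = c`. -/
theorem deg_del_eq_of_sum_eq (D : SimpleGraph V) [DecidableRel D.Adj] (z : V) (c : ℕ)
    (hcap : ∀ v, deg D v ≤ c + 1)
    (hT : ∑ a : {v : V // v ≠ z}, (if D.Adj a.1 z then deg (del D z) a else 0) = deg D z * c)
    (x : {v : V // v ≠ z}) (hx : D.Adj x.1 z) : deg (del D z) x = c := by
  by_contra hne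
  have hlt : deg (del D z) x < c := by
    have h1 := deg_del D z x
    simp only [hx, if_true] at h1
    have := hcap x.1
    omega
  have h1 : ∑ a : {v : V // v ≠ z}, (if D.Adj a.1 z then deg (del D z) a else 0) <
      ∑ a : {v : V // v ≠ z}, (if D.Adj a.1 z then c else 0) := by
    apply sum_lt_sum
    · intro a _
      by_cases h : D.Adj a.1 z
      · simp only [h, if_true]
        have h2 := deg_del D z a
        simp only [h, if_true] at h2
        have := hcap a.1
        omega
      · simp only [h, if_false]
        exact le_refl 0
    · exact ⟨x, mem_univ x, by simp only [hx, if_true]; exact hlt⟩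
  rw [sum_del_nbhd_const, hT] at h1
  exact lt_irrefl _ h1

/-- The arithmetic of the within-row deletion at equality (`a = d + 1 + t`, `r = u + 1 + t`,
`k − 1 = 2d + 3t + u + 2 + j`): the slack `2tu` and the two bounds vanish. -/
theorem band_low_degree_arith_eq (d t u j S T m' : ℕ)
    (hrow : S + u * (2 * d + 3 * t + 1 + j) ≤ m' * (2 * d + 3 * t + u + 2 + j))
    (hT : T ≤ d * (d + 2 * t + u + 1 + j))
    (hm : m' + d + (d + 1 + t) * (d + 1 + t) + (u + 1 + t) = (d + 1 + t) * (2 * d + 3 * t + u + 2 + j + 1))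
    (heq : S + 2 * T + d + d * d + (u + 1 + t) * (2 * d + 2 * t + 1 + j) =
      (m' + d) * (2 * d + 3 * t + u + 2 + j + 1)) :
    t * u = 0 ∧ S + u * (2 * d + 3 * t + 1 + j) = m' * (2 * d + 3 * t + u + 2 + j) ∧
      T = d * (d + 2 * t + u + 1 + j) := by
  have key : 2 * d * (d + 2 * t + u + 1 + j) + d * d + (u + 1 + t) * (2 * d + 2 * t + 1 + j) + d +
      (d + 1 + t) * (d + 1 + t) + (u + 1 + t) + 2 * (t * u) =
      (d + 1 + t) * (2 * d + 3 * t + u + 2 + j + 1) + d * (2 * d + 3 * t + u + 2 + j) +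
        u * (2 * d + 3 * t + 1 + j) := by
    ring
  refine ⟨?_, ?_, ?_⟩
  · have h : t * u ≤ 0 := by nlinarith [hrow, hT, hm, heq, key]
    exact Nat.le_zero.mp h
  · exact le_antisymm hrow (by nlinarith [hrow, hT, hm, heq, key])
  · exact le_antisymm hT (by nlinarith [hrow, hT, hm, heq, key])

/-- **A VERTEX OF LOW DEGREE WITHIN THE ROW, AT EQUALITY:** `d(z) ≤ a − 1`, `r + d(z) ≥ a`, the cap, the row bound
on `D − z`, and equality on `D` ⇒ `d(z) = a − 1` or `r + d(z) = a`; every neighbour of `z` has degree `k − a`; and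
`D − z` attains the bound of its cell. -/
theorem band_of_low_degree_eq (D : SimpleGraph V) [DecidableRel D.Adj] (a r : ℕ)
    (hcap : ∀ v, deg D v + a ≤ Fintype.card V) {z : V} (hd : deg D z + 1 ≤ a) (hrd : a ≤ r + deg D z)
    (hk : r + 2 * a ≤ Fintype.card V) (hm : D.edgeFinset.card + a * a + r = a * Fintype.card V)
    (hrow : ∑ v, deg (del D z) v * deg (del D z) v +
        (r + deg D z - a) * (Fintype.card {v : V // v ≠ z} - 1 - (r + deg D z - a)) ≤
      (del D z).edgeFinset.card * Fintype.card {v : V // v ≠ z})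
    (heq : ∑ v, deg D v * deg D v + r * (Fintype.card V - 1 - r) = D.edgeFinset.card * Fintype.card V) :
    (deg D z + 1 = a ∨ r + deg D z = a) ∧
      (∀ x : {v : V // v ≠ z}, D.Adj x.1 z → deg D x.1 + a = Fintype.card V) ∧
      ∑ v, deg (del D z) v * deg (del D z) v +
        (r + deg D z - a) * (Fintype.card {v : V // v ≠ z} - 1 - (r + deg D z - a)) =
        (del D z).edgeFinset.card * Fintype.card {v : V // v ≠ z} := by
  have hcard := card_del z
  have hedges := card_edges_del D z
  have hsq := sum_deg_sq_del D z
  have hcap' : ∀ v, deg D v ≤ Fintype.card V - a - 1 + 1 := fun v => by have := hcap v; omega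
  have hT := sum_del_nbhd_le D z (Fintype.card V - a - 1) hcap'
  -- the three numbers and the coordinates
  obtain ⟨k', hk'⟩ : ∃ k', Fintype.card {v : V // v ≠ z} = k' := ⟨_, rfl⟩
  obtain ⟨m', hm'⟩ : ∃ m', (del D z).edgeFinset.card = m' := ⟨_, rfl⟩
  obtain ⟨d, hdz⟩ : ∃ d, deg D z = d := ⟨_, rfl⟩
  obtain ⟨T, hTT⟩ : ∃ T, ∑ a : {v : V // v ≠ z}, (if D.Adj a.1 z then deg (del D z) a else 0) = T := ⟨_, rfl⟩
  obtain ⟨S, hS⟩ : ∃ S, ∑ v, deg (del D z) v * deg (del D z) v = S := ⟨_, rfl⟩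
  have hkV : Fintype.card V = k' + 1 := by omega
  have hmD : D.edgeFinset.card = m' + d := by omega
  have hsq' : S + 2 * T + d + d * d + r * (k' + 1 - 1 - r) = (m' + d) * (k' + 1) := by
    rw [← hmD, ← hkV, ← hS, ← hTT, ← hdz, ← hsq]
    exact heq
  have hT' : T ≤ d * (k' + 1 - a - 1) := by rw [← hTT, ← hdz, ← hkV]; exact hT
  have hrow' : S + (r + d - a) * (k' - 1 - (r + d - a)) ≤ m' * k' := by
    rw [← hS, ← hdz, ← hk', ← hm']; exact hrow
  have hmm : m' + d + a * a + r = a * (k' + 1) := by rw [← hmD, ← hkV]; exact hm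
  -- the coordinates: `a = d + 1 + t`, `r = u + 1 + t`, `k' = 2d + 3t + u + 2 + j`
  obtain ⟨t, ht⟩ : ∃ t, a = d + 1 + t := ⟨a - (d + 1), by omega⟩
  obtain ⟨u, hu⟩ : ∃ u, r = u + 1 + t := ⟨r - (1 + t), by omega⟩
  obtain ⟨j, hj⟩ : ∃ j, k' = 2 * d + 3 * t + u + 2 + j := ⟨k' - (2 * d + 3 * t + u + 2), by omega⟩
  have e1 : r + d - a = u := by omega
  have e2 : k' - 1 - u = 2 * d + 3 * t + 1 + j := by omega
  have e3 : k' + 1 - 1 - r = 2 * d + 2 * t + 1 + j := by omega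
  have e4 : k' + 1 - a - 1 = d + 2 * t + u + 1 + j := by omega
  rw [e1, e2] at hrow'
  rw [e3] at hsq'
  rw [e4] at hT'
  rw [ht, hu, hj] at hmm
  rw [hu, hj] at hsq'
  rw [hj] at hrow'
  have key := band_low_degree_arith_eq d t u j S T m' hrow' hT' hmm hsq'
  obtain ⟨htu, hSeq, hTeq⟩ := key
  refine ⟨?_, ?_, ?_⟩
  · rcases Nat.mul_eq_zero.mp htu with h0 | h0
    · left; omega
    · right; omega
  · intro x hx
    have hdeg := deg_del_eq_of_sum_eq D z (Fintype.card V - a - 1) hcap' (by rw [hTT, hdz, hkV, e4, hTeq]) x hx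
    have h1 := deg_del D z x
    simp only [hx, if_true] at h1
    omega
  · rw [hS, hdz, hk', hm', e1, e2, hj]
    exact hSeq

/-- The arithmetic of the cross-row deletion, strict (`a = r + d + 1 + t`, `k − 1 = 3r + 2d + 1 + 2t + j`): the
slack is at least `1`. -/
theorem band_low_degree_cross_arith_strict (r d t j S T m' : ℕ)
    (henv : S ≤ m' * (3 * r + 2 * d + 1 + 2 * t + j)) (hT : T ≤ d * (2 * r + d + t + j))
    (hm : m' + d + (r + d + 1 + t) * (r + d + 1 + t) + r =
      (r + d + 1 + t) * (3 * r + 2 * d + 1 + 2 * t + j + 1)) :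
    S + 2 * T + d + d * d + r * (2 * r + 2 * d + 1 + 2 * t + j) + 1 ≤
      (m' + d) * (3 * r + 2 * d + 1 + 2 * t + j + 1) := by
  have key : 2 * d * (2 * r + d + t + j) + d + d * d + r * (2 * r + 2 * d + 1 + 2 * t + j) + d +
      (r + d + 1 + t) * (r + d + 1 + t) + r + 1 ≤
      (r + d + 1 + t) * (3 * r + 2 * d + 1 + 2 * t + j + 1) + d * (3 * r + 2 * d + 1 + 2 * t + j) + d := by
    nlinarith [Nat.zero_le (r * t), Nat.zero_le (d * t), Nat.zero_le (t * t), Nat.zero_le (t * j)]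
  nlinarith [henv, hT, key, hm]

/-- **A VERTEX OF LOW DEGREE ACROSS THE ROW IS NEVER TIGHT:** `r + d(z) ≤ a − 1` with the cap ⇒
`Σ_v d(v)² + r (k − 1 − r) + 1 ≤ m k` (`k ≥ 7`). -/
theorem band_of_low_degree_cross_strict (D : SimpleGraph V) [DecidableRel D.Adj] (hK : K4mFree D) (a r : ℕ)
    (hcap : ∀ v, deg D v + a ≤ Fintype.card V) {z : V} (hrd : r + deg D z + 1 ≤ a)
    (hk : r + 2 * a ≤ Fintype.card V) (hk7 : 7 ≤ Fintype.card V)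
    (hm : D.edgeFinset.card + a * a + r = a * Fintype.card V) :
    ∑ v, deg D v * deg D v + r * (Fintype.card V - 1 - r) + 1 ≤ D.edgeFinset.card * Fintype.card V := by
  have hcard := card_del z
  have hedges := card_edges_del D z
  have hsq := sum_deg_sq_del D z
  have hT := sum_del_nbhd_le D z (Fintype.card V - a - 1) (fun v => by have := hcap v; omega)
  have hK' := k4mFree_del D hK z
  have henv := sum_deg_sq_le_of_k4mFree (del D z) hK' (by omega)
  obtain ⟨k', hk'⟩ : ∃ k', Fintype.card {v : V // v ≠ z} = k' := ⟨_, rfl⟩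
  obtain ⟨m', hm'⟩ : ∃ m', (del D z).edgeFinset.card = m' := ⟨_, rfl⟩
  obtain ⟨d, hdz⟩ : ∃ d, deg D z = d := ⟨_, rfl⟩
  obtain ⟨T, hTT⟩ : ∃ T, ∑ a : {v : V // v ≠ z}, (if D.Adj a.1 z then deg (del D z) a else 0) = T := ⟨_, rfl⟩
  obtain ⟨S, hS⟩ : ∃ S, ∑ v, deg (del D z) v * deg (del D z) v = S := ⟨_, rfl⟩
  rw [hk'] at hcard henv
  rw [hm'] at hedges henv
  rw [hdz] at hedges hsq hT hrd
  rw [hTT] at hsq hT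
  rw [hS] at hsq henv
  have hkV : Fintype.card V = k' + 1 := by omega
  have hmD : D.edgeFinset.card = m' + d := by omega
  rw [hkV, hmD]
  rw [hkV] at hm hT hk
  rw [hmD] at hm
  rw [hsq]
  obtain ⟨t, rfl⟩ : ∃ t, a = r + d + 1 + t := ⟨a - (r + d + 1), by omega⟩
  obtain ⟨j, rfl⟩ : ∃ j, k' = 3 * r + 2 * d + 1 + 2 * t + j := ⟨k' - (3 * r + 2 * d + 1 + 2 * t), by omega⟩
  have e3 : 3 * r + 2 * d + 1 + 2 * t + j + 1 - 1 - r = 2 * r + 2 * d + 1 + 2 * t + j := by omega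
  have e4 : 3 * r + 2 * d + 1 + 2 * t + j + 1 - (r + d + 1 + t) - 1 = 2 * r + d + t + j := by omega
  rw [e3]
  rw [e4] at hT
  have := band_low_degree_cross_arith_strict r d t j S T m' henv hT hm
  linarith

/-- The complement of a bipartition is a bipartition. -/
theorem bipSub_compl (H : SimpleGraph V) (A : Finset V) (hH : BipSub H A) : BipSub H Aᶜ := by
  intro x y h
  have := hH x y h
  simp only [mem_compl]
  tauto

/-- In a spanning subgraph of `K(A, Aᶜ)` a vertex off `A` has degree at most `|A|`. -/
theorem deg_le_card_of_bipSub (H : SimpleGraph V) [DecidableRel H.Adj] (A : Finset V) (hH : BipSub H A) (y : V)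
    (hy : y ∉ A) : deg H y ≤ A.card := by
  unfold deg
  apply card_le_card
  intro w hw
  rw [mem_filter] at hw
  have := hH y w hw.2
  tauto

/-- In a spanning subgraph of `K(A, Aᶜ)` a vertex off `A` of degree `|A|` is adjacent to all of `A`. -/
theorem adj_of_deg_eq_card_of_bipSub (H : SimpleGraph V) [DecidableRel H.Adj] (A : Finset V) (hH : BipSub H A)
    (y : V) (hy : y ∉ A) (hdeg : deg H y = A.card) (x : V) (hx : x ∈ A) : H.Adj y x := by
  have hsub : univ.filter (fun w => H.Adj y w) ⊆ A := by
    intro w hw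
    rw [mem_filter] at hw
    have := hH y w hw.2
    tauto
  have heq : univ.filter (fun w => H.Adj y w) = A := eq_of_subset_of_card_le hsub (by unfold deg at hdeg; omega)
  have : x ∈ univ.filter (fun w => H.Adj y w) := by rw [heq]; exact hx
  exact (mem_filter.mp this).2

omit [Fintype V] in
/-- **The lift of a bipartition along a vertex deletion:** if `D − z ≤ K(B', B'ᶜ)` and every neighbour of `z`
lies in `B'`, then `D ≤ K(B, Bᶜ)` for `B` the image of `B'` in `V` (`z ∉ B`), with `|B| = |B'|`. -/
theorem bipSub_lift (D : SimpleGraph V) (z : V) (B' : Finset {v : V // v ≠ z}) (hsub : BipSub (del D z) B')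
    (hnb : ∀ x : {v : V // v ≠ z}, D.Adj x.1 z → x ∈ B') :
    ∃ B : Finset V, B.card = B'.card ∧ BipSub D B := by
  refine ⟨B'.map (Function.Embedding.subtype _), card_map _, ?_⟩
  have hmem : ∀ x : {v : V // v ≠ z}, x.1 ∈ B'.map (Function.Embedding.subtype _) ↔ x ∈ B' := fun x =>
    mem_map' _
  have hz : z ∉ B'.map (Function.Embedding.subtype _) := by
    rw [mem_map]
    rintro ⟨x, _, hx⟩
    exact x.2 hx
  intro x y hxy
  by_cases hxz : x = z
  · subst hxz
    have hy : y ≠ x := hxy.ne.symm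
    have := hnb ⟨y, hy⟩ hxy.symm
    rw [← hmem ⟨y, hy⟩] at this
    tauto
  by_cases hyz : y = z
  · subst hyz
    have := hnb ⟨x, hxz⟩ hxy
    rw [← hmem ⟨x, hxz⟩] at this
    tauto
  have h := hsub ⟨x, hxz⟩ ⟨y, hyz⟩ hxy
  rw [← hmem ⟨x, hxz⟩, ← hmem ⟨y, hyz⟩] at h
  exact h

/-- **THE TRANSPORT:** `D − z ≤ K(A', A'ᶜ)` with `|A'| = a`, every neighbour of `z` at the cap `k − a`, and
`k − 1 − a > a` or (`d(z) ≥ 3` and `k − 1 = 2a`) ⇒ `D ≤ K(A, Aᶜ)` for some `A` with `|A| = a`. -/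
theorem bipSub_of_del (D : SimpleGraph V) [DecidableRel D.Adj] (hK : K4mFree D) (z : V) (a : ℕ)
    (A' : Finset {v : V // v ≠ z}) (hA' : A'.card = a) (hsub : BipSub (del D z) A')
    (hnb : ∀ x : {v : V // v ≠ z}, D.Adj x.1 z → deg D x.1 + a = Fintype.card V)
    (hside : a + a + 1 < Fintype.card V ∨ (3 ≤ deg D z ∧ Fintype.card V = a + a + 1)) :
    ∃ A : Finset V, A.card = a ∧ BipSub D A := by
  have hcard := card_del z
  -- a neighbour of `z` has degree `k − 1 − a` in `D − z`
  have hdel : ∀ x : {v : V // v ≠ z}, D.Adj x.1 z → deg (del D z) x + 1 + a = Fintype.card V := by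
    intro x hx
    have h1 := deg_del D z x
    simp only [hx, if_true] at h1
    have := hnb x hx
    omega
  have hAc : A'ᶜ.card + a = Fintype.card V - 1 := by
    rw [card_compl, hA']
    have := card_le_univ A'
    omega
  rcases hside with hbig | ⟨hthree, hk⟩
  · -- the sides differ: a neighbour of `z` cannot lie off `A'`
    have hin : ∀ x : {v : V // v ≠ z}, D.Adj x.1 z → x ∈ A' := by
      intro x hx
      by_contra hxA
      have h1 := deg_le_card_of_bipSub (del D z) A' hsub x hxA
      have h2 := hdel x hx
      omega
    obtain ⟨B, hB, hBsub⟩ := bipSub_lift D z A' hsub hin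
    exact ⟨B, by rw [hB, hA'], hBsub⟩
  · -- `k − 1 = 2a`, `d(z) ≥ 3`: the neighbours of `z` lie on one side, else `K₄⁻`
    have hsubc := bipSub_compl (del D z) A' hsub
    by_cases hin : ∀ x : {v : V // v ≠ z}, D.Adj x.1 z → x ∈ A'
    · obtain ⟨B, hB, hBsub⟩ := bipSub_lift D z A' hsub hin
      exact ⟨B, by rw [hB, hA'], hBsub⟩
    by_cases hout : ∀ x : {v : V // v ≠ z}, D.Adj x.1 z → x ∈ A'ᶜ
    · obtain ⟨B, hB, hBsub⟩ := bipSub_lift D z A'ᶜ hsubc hout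
      exact ⟨B, by rw [hB]; omega, hBsub⟩
    -- a neighbour `x ∈ A'` and a neighbour `y ∉ A'`: `x ∼ y`, and a third neighbour `w` closes a `K₄⁻`
    push Not at hin hout
    obtain ⟨y, hy, hyA⟩ := hin
    obtain ⟨x, hx, hxA⟩ := hout
    rw [mem_compl, not_not] at hxA
    exfalso
    have hxc : x ∉ A'ᶜ := by rw [mem_compl]; exact not_not.mpr hxA
    have hxfull : ∀ w, w ∈ A'ᶜ → (del D z).Adj x w :=
      adj_of_deg_eq_card_of_bipSub (del D z) A'ᶜ hsubc x hxc (by have := hdel x hx; omega)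
    have hyfull : ∀ w, w ∈ A' → (del D z).Adj y w :=
      adj_of_deg_eq_card_of_bipSub (del D z) A' hsub y hyA (by have := hdel y hy; omega)
    have hxy : D.Adj x.1 y.1 := hxfull y (mem_compl.mpr hyA)
    -- a third neighbour
    obtain ⟨w, hw, hwx, hwy⟩ : ∃ w, D.Adj z w ∧ w ≠ x.1 ∧ w ≠ y.1 := by
      by_contra hno
      push Not at hno
      have hsub2 : univ.filter (fun w => D.Adj z w) ⊆ {x.1, y.1} := by
        intro w hw
        rw [mem_filter] at hw
        rw [mem_insert, mem_singleton]
        by_contra hc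
        push Not at hc
        exact hc.2 (hno w hw.2 hc.1)
      have h1 := card_le_card hsub2
      have h2 := card_le_two (a := x.1) (b := y.1)
      unfold deg at hthree
      omega
    have hwz : w ≠ z := hw.ne.symm
    by_cases hwA : (⟨w, hwz⟩ : {v : V // v ≠ z}) ∈ A'
    · -- `w ∈ A'`: `y ∼ w`
      have hyw : D.Adj y.1 w := hyfull _ hwA
      exact not_adj_both D hK (u := z) (v := y.1) (w := x.1) (x := w) hy.symm hx.symm hxy.symm hwx.symm hw hyw
    · -- `w ∉ A'`: `x ∼ w`
      have hxw : D.Adj x.1 w := hxfull _ (mem_compl.mpr hwA)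
      exact not_adj_both D hK (u := z) (v := x.1) (w := y.1) (x := w) hx.symm hy.symm hxy hwy.symm hw hxw

end C047

end TriangleCap

end PercRepro
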